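import Summits.QuantumFields.YangMills.Theorems.BalabanUVNodesN16HolderMSDefs
import Summits.QuantumFields.YangMills.Theorems.BalabanUVNodesN16AtRRec13CoPLines
import Summits.QuantumFields.YangMills.Theorems.BalabanUVNodesRateReadingOfRecord13CoP

/-!
# Route «BalabanUVNodes», cluster K4 «SpineRates» — node N16 = NE3: THE HOME SIDE OF REPAIR R-β″ AT NODE 00's STAGE-13 RECORD — dag-n16-c's candidate stub
# `S_N16HolderMS β` (the covariant root with the MULTI-SCALE (3.40) Hölder member) at the rate homes `RRec₁₃CoPOn 𝔯 Rg` ∕ `RRec₁₃CoP 𝔯`, at RR-1's NE3 object of record, and at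
# dag-n22-e's NAMED reading of record `readingOfRecord₁₃CoP w1 ℓ₃ ne2 ne1`; N21's MS-face; the weakening ladder MS ⇒ β ⇒ (β = 1) the stub of record, AT THE HOMES

CoP EDITION (director-ym №160–№162 «(y) FINAL», def-T KEY-23 ∕ KEY-24T, plan g68 KEY-20, dag-lead WORDS-141 — 2026-08-27): RECORD 13 v1.5 re-seeded BOTH cones at
print's collar-ranged 𝐓-weights and print's (1.7)∧(1.9)-class minimiser with scale-0 data on `suppDomOfRecord` — def-T's FILE 23 `Node00/Record13CoP.lean` carries
`towerOfRecord₁₃CoP ∕ datumOfRecord₁₃CoP` keyed on the UNCHANGED bg-free core proviso `Stage13Params.Provisos₁₃Core` and the record class `IsRecordOfRecord₁₃CCoP`; RR-2's key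
`Node00/Record13DatumKeyCoP` (`IsDatumOfRecord₁₃CCoP(On∕N)`, `IsRateKey₁₃CoP`, `canon₁₃CoP(On)`) and dag-n22-e's (T-RATE) layer-B ∕ reading-of-record CoP twins (`RateReading₁₃CoP`,
`rateCarriersOfRecord₁₃CoP`, `RRec₁₃CoP`, `RRec₁₃CoPOn`, `readingOfRecord₁₃CoP`, …) followed; the items K0⁵–K3⁵ (stmt-QuantumFields-20293–20296) key on v1.5 `Provisos₁₃SepCoP` ∕
`datumOfRecord₁₃SepCoP` (= `datumOfRecord₁₃CoP θ h.toCore`, `rfl`), so bg-blind CONSUMER storeys key ONCE on the core proviso at the CoP datum (plan CORE-YES; HOLD-ALL «rev 20 keys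
once»; the edition is FROZEN): THIS is the edition of record of this module; its ⁗ ∕ Co siblings are asides.  THIS FILE is the TOKEN TWIN of this seat's ⁗ module of the same
name with `Sep ↦ CoP` on the record ∕ datum ∕ home stems and `Provisos₁₃Sep ↦ Provisos₁₃Core` on the binder — statements = the ⁗ statements under that map; proofs verbatim;
θ-level names VERBATIM; stage-free lemmas NOT re-declared (imported from the ‴ modules BY NAME); the tuple-currency (K3 `KeyedRates rr`) conjuncts CITED from this seat's
proviso-GENERIC modules `…N16AtTupleReading13Generic` ∕ `…N16HolderMSAtTupleReading13Generic` (p512669 ∕ p512908).  NOTE (LOCATED-4∕5 of dag-n16-e ∕ dag-n16-c): every «THE N16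
LINE» below keeps the ⁗ statement's N05 conjunct on the law-free univ sub-family and is therefore VACUOUS as stated (n16-c F49); the LIVE lines with the conjunct at the pinned
all-torus proper sub-index are this seat's `…AllTorusAtRecord13CoP` modules over the faces ∕ iffs of THIS file.  The ‴∕⁗ item ids named below are ASIDES; the lane is K3⁵
`SpineGivenEndpointR13SepCoP` = stmt-QuantumFields-20296 (dag-lead WORDS-141).

Cell `pub-ymgap`, seat `pub-ymgap-dag-n16-e` (R134 acceleration seat (a), strategy s2 = BY-NAME KNIT at the record; HUMAN RULING D-0062; chair R424 venue),
generation 6, module 22 (THEOREMS ONLY, 0 `def`, 0 `sorry`).  `bears_on: R4∕N16 · out-edge N16 → N21 · K3‴ SpineGivenEndpointR13 (stmt-QuantumFields-19912,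
`--supports … --as helper`, dag-lead KEY TABLE WORDS-133 ∕ FAN-OUT v1.3)`.  pub-ymgap INBOX DAGN16E-G6-STARTED ∕ INTENT-22.

WHY.  dag-n16-c g4 opened a THIRD repair option for the located item «the Hölder-exponent pin of N16's N05-socket» (`HOME/pub-ymgap-dag-n16-c/LOCATED-N16-HOLDER-PIN.md`):
R-β″ = the WINDOW-FREE Hölder road — the β-root's third covariant conjunct read ALONG LATTICE LINES at every separation `1 ≤ j ≤ L^k` (the multi-scale member of
[Balaban1985BackgroundPropagators] (3.40), i.e. of [Balaban1985RegularSpaces] (1.36)), under which NE7's consumers survive for EVERY `β > 0` (`…N16HolderMultiScale(Rates)`,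
p491275 ∕ p491997) — and landed its DEFINITIONS `…N16HolderMSDefs` (p492484: `CovRootHolderMS`, `N16HolderMSAt c β`, the candidate stub `S_N16HolderMS β RRec`, N21's MS
consumer END `closeness_of_covRootHolderMS`, the projections `covRootHolder_of_covRootHolderMS` ∕ `s_N16Holder_of_s_N16HolderMS` ∕ `s_N16_of_s_N16HolderMS_one`) together with
the MS producer column.  For R-β this seat landed the HOME side (F1) `…N16HolderAtRecord12` (p482004) and its Stage-13 successor module 20 `…N16AtRRec13CoPLines` §1–§3 (p494677)
over dag-n16-c's β-kit; this module is the same HOME side in the MS currency, so that on an R-β″ ruling the K3‴ composer's `h16 : S_N16HolderMS β (RRec₁₃CoPOn 𝔯 (unityNondeg₁₃ 2))`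
and N21's MS consumer END meet BY NAME at the Stage-13 record exactly as R-β's two sides do today — nothing of the MS kit is orphaned and nothing of record is edited.

CONTENT (every theorem a ONE-APPLICATION composition BY NAME; the (T-RATE) generic master face `rateStub_rRec₁₃CoPOn_iff`, RR-1's constant layer `ne3ConstLayerOfRecord₁₁`,
dag-n22-e's `readingOfRecord₁₃CoP_ne3` (`rfl`), dag-n16-c's projections).
§1 MASTER FACES — `s_N16HolderMS_rRec₁₃CoPOn_iff` (guarded θ-form), `s_N16HolderMS_rRec₁₃CoP_iff`; `s_N16HolderMS_rRec₁₃CoPOn_anti`, `s_N16HolderMS_rRec₁₃CoP_of_rRec₁₃CoPOn_true`; THE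
  WEAKENING LADDER AT THE HOMES, side-condition-free (the block factor `1 ≤ R.ne3.L` dag-n16-c's projections ask is the family's `2 ≤ F.L` on every pinned bundle):
  `s_N16Holder_rRec₁₃CoPOn_of_s_N16HolderMS`, `s_N16Holder_rRec₁₃CoP_of_s_N16HolderMS`, `s_N16_rRec₁₃CoPOn_of_s_N16HolderMS_one`, `s_N16_rRec₁₃CoP_of_s_N16HolderMS_one`.
§2 CONSTANT NE3 LAYERS — `s_N16HolderMS_rRec₁₃CoPOn_iff_of_constLayer`, `s_N16HolderMS_rRec₁₃CoP_iff_of_constLayer`, `s_N16HolderMS_rRec₁₃CoPOn_of_s_N16HolderMS_rRec₁₃CoP_constLayer`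
  (the two homes agree: canonical ⇒ regime-restricted, every regime).
§3 AT RR-1's NE3 OBJECT OF RECORD (`hpin`-generic) — `s_N16HolderMS_rRec₁₃CoPOn_iff_ofRecord`, `n16HolderMSAt_of_s_N16HolderMS_rRec₁₃CoPOn_ofRecord`, ★ N21's MS-FACE
  `covRootHolderMS_rRec₁₃CoPOn_ofRecord` (`CovRootHolderMS 4 (sfClass …) … β (ne3DomOfRecord₁₁ F N 0 0)` at every guarded family — the `h` of `closeness_of_covRootHolderMS`),
  `s_N16HolderMS_rRec₁₃CoP_iff_ofRecord`, `covRootHolderMS_rRec₁₃CoP_ofRecord`, `s_N16HolderMS_rRec₁₃CoPOn_ofRecord_of_rRec₁₃CoP`.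
§4 AT THE NAMED STAGE-13 READING OF RECORD `readingOfRecord₁₃CoP w1 ℓ₃ ne2 ne1` (dag-n22-e 6″, p495075; `hpin := readingOfRecord₁₃CoP_ne3`) — `s_N16HolderMS_readingOfRecord₁₃CoPOn_iff`,
  `s_N16HolderMS_readingOfRecord₁₃CoP_iff`, `covRootHolderMS_readingOfRecord₁₃CoPOn`, `covRootHolderMS_readingOfRecord₁₃CoP`.
§5 HONESTY (R422) — `s_N16HolderMS_rRec₁₃CoPOn_of_guard_empty` (vacuous on an empty guard), `not_s_N16HolderMS_rRec₁₃CoPOn_of_not_s_N16Holder` (the MS stub is refuted wherever the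
  β-stub is: every junk test of modules 19 ∕ 20 transfers).

NOT HERE (dag-n16-c's custody unless declined; pub-ymgap INBOX DAGN16E-G6-STARTED): the record-level MS regime ∕ slot kit (`PrintSlotHolderMS`, `radiusOfRecordHMS`,
`constOfRecordHMS`, `InEndRegimeHMS`, `LeafSlotHolderMS`) and the MS N16 LINE — their entry `leafSlotHolderMS_of_b8LeafRS` waits on the MS producer tops (R1)–(R7).

HONEST FRAMING.  Kernel bookkeeping by name; no estimate; `S_N16HolderMS β` is dag-n16-c's CANDIDATE stub wording for the located repair R-β″ — the statement edit is the planner's ∕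
director's (R-β ∕ R-β″ ∕ R-Δ ∕ status quo UNRULED), nothing of record is edited; the reading `𝔯` is a PARAMETER pinned only through `hpin` (§4: dag-n22-e's named reading, whose
`w1` ∕ `ne2` ∕ `ne1` are residual DATA); no admissible Stage-13 tuple with provisos is claimed to exist (K0‴ `Record13Inhabited`, stmt-QuantumFields-19909, OPEN); nothing of
Bałaban's is asserted; **N16 ∕ NE3 is NOT discharged**; count-neutral (typed 28∕28 · discharged 5∕27, A 5∕28 UNMOVED); one finite four-torus at fixed ε — NOT ℝ⁴, NOT infinite
volume, NOT OS, NOT a mass gap, NOT Clay.  No decl below carries a cite tag (all `[folklore]` bookkeeping).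
-/

set_option autoImplicit false

open scoped BigOperators Matrix Matrix.Norms.L2Operator
open NormedSpace

namespace Summit.QuantumFields.YangMills.BalabanUVNodes.N16HolderMSAtRecord13CoP

open Literature.MathematicalPhysics.QuantumFieldTheory.Balaban1983to89
open Literature.MathematicalPhysics.QuantumFieldTheory.Balaban1983to89.T4Continuum (T4Family ULoop)
open B7Prop1Explicit B7Prop2Explicit
open Node00 (IsDatumOfRecord₁₃CCoP Stage13Params NE3Objects₁₁ NE3Letters₁₁ NE2Objects₁₁ ne3LOfRecord₁₁ ne3ConstLayerOfRecord₁₁ ne3NperOfRecord₁₁ ne3DomOfRecord₁₁ MatA)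
open Node00.W1 (ReadingData)
open Summit.QuantumFields.BalabanUV.T4Continuum
open MinimalActionRate (sfClass)
open YMDAG.UVSplit (Datum NE3Carriers NE1pCarriers RateCarriers S_N16 ne3OfRecord₁₁ RateReading₁₃CoP RRec₁₃CoP RRec₁₃CoPOn rateStub_rRec₁₃CoPOn_iff rRec₁₃CoPOn_mono
  rRec₁₃CoP_le_rRec₁₃CoPOn_true rRec₁₃CoPOn_self readingOfRecord₁₃CoP readingOfRecord₁₃CoP_ne3)
open Summit.QuantumFields.YangMills.BalabanUVNodes.N16HolderDefs (S_N16Holder)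
open Summit.QuantumFields.YangMills.BalabanUVNodes.N16HolderMSDefs (CovRootHolderMS N16HolderMSAt S_N16HolderMS s_N16Holder_of_s_N16HolderMS s_N16_of_s_N16HolderMS_one)
open Summit.QuantumFields.YangMills.BalabanUVNodes.N16AtRRec13CoPLines (s_N16Holder_rRec₁₃CoPOn_iff_of_constLayer)

noncomputable section

variable {N : ℕ} [NeZero N] (β : ℝ) (𝔯 : RateReading₁₃CoP N) (Rg : (F : T4Family) → Stage13Params F N → Prop)

/-! ## §1 Master faces, regime monotonicity, the weakening ladder at the homes -/

/-- **`S_N16HolderMS β` AT THE REGIME-RESTRICTED HOME — GUARDED θ-FORM**: `S_N16HolderMS β (RRec₁₃CoPOn 𝔯 Rg)` iff for every family, every admissible Stage-13 tuple `θ` with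
provisos `hP` in `Rg`, every `(g₀, os)` and run length `k`, `N16HolderMSAt (ne3OfRecord₁₁ F ((𝔯.lit F θ hP g₀ os).ne3 k)) β` (dag-n22-e's `rateStub_rRec₁₃CoPOn_iff`). [folklore] -/
theorem s_N16HolderMS_rRec₁₃CoPOn_iff :
    S_N16HolderMS β (RRec₁₃CoPOn 𝔯 Rg) ↔ ∀ (F : T4Family) (θ : Stage13Params F N) (hP : θ.Provisos₁₃Core F N), Rg F θ → θ.Admissible F N →
      ∀ (g₀ : ℕ → ℝ) (os : List (ULoop F)) (k : ℕ), N16HolderMSAt (ne3OfRecord₁₁ F ((𝔯.lit F θ hP g₀ os).ne3 k)) β :=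
  rateStub_rRec₁₃CoPOn_iff 𝔯 Rg fun _ R => N16HolderMSAt R.ne3 β

/-- **`S_N16HolderMS β` AT THE CANONICAL HOME**: iff for every family, datum with its Stage-13 key `h`, `(g₀, os)` and run length `k`,
`N16HolderMSAt (ne3OfRecord₁₁ F ((𝔯.lit F h.params h.provisos g₀ os).ne3 k)) β`. [folklore] -/
theorem s_N16HolderMS_rRec₁₃CoP_iff :
    S_N16HolderMS β (RRec₁₃CoP 𝔯) ↔ ∀ (F : T4Family) (D : Datum F N) (h : IsDatumOfRecord₁₃CCoP F N D) (g₀ : ℕ → ℝ) (os : List (ULoop F)) (k : ℕ),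
      N16HolderMSAt (ne3OfRecord₁₁ F ((𝔯.lit F h.params h.provisos g₀ os).ne3 k)) β := by
  constructor
  · intro hS F D h g₀ os k
    exact hS F D g₀ os _ ⟨h, k, rfl⟩
  · rintro hS F D g₀ os R ⟨h, k, rfl⟩
    exact hS F D h g₀ os k

/-- **ANTITONE IN THE REGIME**: a larger regime asks more. [folklore] -/
theorem s_N16HolderMS_rRec₁₃CoPOn_anti {Rg Rg' : (F : T4Family) → Stage13Params F N → Prop} (h : ∀ F θ, Rg F θ → Rg' F θ)
    (hS : S_N16HolderMS β (RRec₁₃CoPOn 𝔯 Rg')) : S_N16HolderMS β (RRec₁₃CoPOn 𝔯 Rg) :=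
  fun F D g₀ os R hR => hS F D g₀ os R (rRec₁₃CoPOn_mono 𝔯 h hR)

/-- **THE TRIVIAL REGIME COVERS THE CANONICAL HOME**. [folklore] -/
theorem s_N16HolderMS_rRec₁₃CoP_of_rRec₁₃CoPOn_true (hS : S_N16HolderMS β (RRec₁₃CoPOn 𝔯 fun _ _ => True)) : S_N16HolderMS β (RRec₁₃CoP 𝔯) :=
  fun F D g₀ os R hR => hS F D g₀ os R (rRec₁₃CoP_le_rRec₁₃CoPOn_true 𝔯 hR)

/-- **THE WEAKENING MS ⇒ β AT THE REGIME-RESTRICTED HOME, NO SIDE CONDITION**: `S_N16HolderMS β (RRec₁₃CoPOn 𝔯 Rg) → S_N16Holder β (RRec₁₃CoPOn 𝔯 Rg)` — dag-n16-c's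
`s_N16Holder_of_s_N16HolderMS` asks the block factor `1 ≤ R.ne3.L` of every pinned bundle; at this home every pinned bundle is `ne3OfRecord₁₁ F _`, whose block factor is the
family's `F.L ≥ 2`. [folklore] -/
theorem s_N16Holder_rRec₁₃CoPOn_of_s_N16HolderMS (hS : S_N16HolderMS β (RRec₁₃CoPOn 𝔯 Rg)) : S_N16Holder β (RRec₁₃CoPOn 𝔯 Rg) :=
  s_N16Holder_of_s_N16HolderMS hS fun F D g₀ os R hR => by
    obtain ⟨θ, hP, -, -, -, k, rfl⟩ := hR
    exact le_trans one_le_two (HistoryFlow.two_le_L F)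

/-- **THE WEAKENING MS ⇒ β AT THE CANONICAL HOME, NO SIDE CONDITION**. [folklore] -/
theorem s_N16Holder_rRec₁₃CoP_of_s_N16HolderMS (hS : S_N16HolderMS β (RRec₁₃CoP 𝔯)) : S_N16Holder β (RRec₁₃CoP 𝔯) :=
  s_N16Holder_of_s_N16HolderMS hS fun F D g₀ os R hR => by
    obtain ⟨h, k, rfl⟩ := hR
    exact le_trans one_le_two (HistoryFlow.two_le_L F)

/-- **AT `β = 1` THE MS STUB IMPLIES THE STUB OF RECORD AT THE REGIME-RESTRICTED HOME, NO SIDE CONDITION**: `S_N16HolderMS 1 (RRec₁₃CoPOn 𝔯 Rg) → S_N16 (RRec₁₃CoPOn 𝔯 Rg)`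
(dag-n16-c's `s_N16_of_s_N16HolderMS_one`; the K3‴ composer's `h16` of record from the MS wording at exponent one). [folklore] -/
theorem s_N16_rRec₁₃CoPOn_of_s_N16HolderMS_one (hS : S_N16HolderMS 1 (RRec₁₃CoPOn 𝔯 Rg)) : S_N16 (RRec₁₃CoPOn 𝔯 Rg) :=
  s_N16_of_s_N16HolderMS_one hS fun F D g₀ os R hR => by
    obtain ⟨θ, hP, -, -, -, k, rfl⟩ := hR
    exact le_trans one_le_two (HistoryFlow.two_le_L F)

/-- **AT `β = 1` THE MS STUB IMPLIES THE STUB OF RECORD AT THE CANONICAL HOME, NO SIDE CONDITION**. [folklore] -/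
theorem s_N16_rRec₁₃CoP_of_s_N16HolderMS_one (hS : S_N16HolderMS 1 (RRec₁₃CoP 𝔯)) : S_N16 (RRec₁₃CoP 𝔯) :=
  s_N16_of_s_N16HolderMS_one hS fun F D g₀ os R hR => by
    obtain ⟨h, k, rfl⟩ := hR
    exact le_trans one_le_two (HistoryFlow.two_le_L F)

/-! ## §2 Readings with a constant NE3 layer; the two Stage-13 homes agree -/

section ConstLayer

variable (o : T4Family → NE3Objects₁₁ N)
  (hpin : ∀ (F : T4Family) (θ : Stage13Params F N) (hP : θ.Provisos₁₃Core F N) (g₀ : ℕ → ℝ) (os : List (ULoop F)) (k : ℕ), (𝔯.lit F θ hP g₀ os).ne3 k = o F)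
include hpin

/-- **FOR A READING WHOSE NE3 COMPONENT IS CONSTANTLY `o F`, `S_N16HolderMS β (RRec₁₃CoPOn 𝔯 Rg)` IS ONE `N16HolderMSAt … β` PER GUARDED FAMILY.** [folklore] -/
theorem s_N16HolderMS_rRec₁₃CoPOn_iff_of_constLayer :
    S_N16HolderMS β (RRec₁₃CoPOn 𝔯 Rg) ↔ ∀ (F : T4Family), (∃ θ : Stage13Params F N, θ.Provisos₁₃Core F N ∧ Rg F θ ∧ θ.Admissible F N) →
      N16HolderMSAt (ne3OfRecord₁₁ F (o F)) β := by
  rw [s_N16HolderMS_rRec₁₃CoPOn_iff]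
  constructor
  · rintro h F ⟨θ, hP, hRg, hθ⟩
    have h' := h F θ hP hRg hθ (fun _ => 0) [] 0
    rwa [hpin] at h'
  · intro h F θ hP hRg hθ g₀ os k
    rw [hpin]
    exact h F ⟨θ, hP, hRg, hθ⟩

/-- **THE SAME AT THE CANONICAL HOME**: one `N16HolderMSAt … β` per family carrying a Stage-13 datum of record. [folklore] -/
theorem s_N16HolderMS_rRec₁₃CoP_iff_of_constLayer :
    S_N16HolderMS β (RRec₁₃CoP 𝔯) ↔ ∀ (F : T4Family), (∃ D : Datum F N, IsDatumOfRecord₁₃CCoP F N D) → N16HolderMSAt (ne3OfRecord₁₁ F (o F)) β := by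
  rw [s_N16HolderMS_rRec₁₃CoP_iff]
  constructor
  · rintro h F ⟨D, hD⟩
    have h' := h F D hD (fun _ => 0) [] 0
    rwa [hpin] at h'
  · intro h F D hD g₀ os k
    rw [hpin]
    exact h F ⟨D, hD⟩

/-- **THE TWO STAGE-13 HOMES AGREE AT A CONSTANT LAYER — CANONICAL ⇒ REGIME-RESTRICTED, EVERY REGIME**: a guarded admissible tuple with provisos realises a Stage-13 datum of
record (the (T-RATE) face `RRec₁₃CoPOn.isDatumOfRecord₁₃CCoP` at `rRec₁₃CoPOn_self`), at which the canonical home's sentence reads `N16HolderMSAt (ne3OfRecord₁₁ F (o F)) β`; the object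
being tuple-free, that is all the regime-restricted home asks. [folklore] -/
theorem s_N16HolderMS_rRec₁₃CoPOn_of_s_N16HolderMS_rRec₁₃CoP_constLayer (hS : S_N16HolderMS β (RRec₁₃CoP 𝔯)) : S_N16HolderMS β (RRec₁₃CoPOn 𝔯 Rg) :=
  (s_N16HolderMS_rRec₁₃CoPOn_iff_of_constLayer β 𝔯 Rg o hpin).2 fun F ⟨θ, hP, hRg, hθ⟩ =>
    (s_N16HolderMS_rRec₁₃CoP_iff_of_constLayer β 𝔯 o hpin).1 hS F ⟨_, (rRec₁₃CoPOn_self 𝔯 Rg θ hP hRg hθ (fun _ => 0) [] 0).isDatumOfRecord₁₃CCoP⟩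

end ConstLayer

/-! ## §3 `S_N16HolderMS β` at RR-1's NE3 object of record (`hpin`-generic: at the named Stage-13 reading of record `hpin := readingOfRecord₁₃CoP_ne3 …`, §4) -/

section OfRecord

variable (ℓ : T4Family → NE3Letters₁₁)
  (hpin : ∀ (F : T4Family) (θ : Stage13Params F N) (hP : θ.Provisos₁₃Core F N) (g₀ : ℕ → ℝ) (os : List (ULoop F)) (k : ℕ),
    (𝔯.lit F θ hP g₀ os).ne3 k = ne3ConstLayerOfRecord₁₁ F N (ℓ F))
include hpin

/-- **`S_N16HolderMS β` AT THE OBJECT OF RECORD, REGIME-RESTRICTED HOME** IS «`N16HolderMSAt (ne3OfRecord₁₁ F (ne3ConstLayerOfRecord₁₁ F N (ℓ F))) β` for every family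
carrying an admissible Stage-13 tuple with provisos in `Rg`». [folklore] -/
theorem s_N16HolderMS_rRec₁₃CoPOn_iff_ofRecord :
    S_N16HolderMS β (RRec₁₃CoPOn 𝔯 Rg) ↔ ∀ (F : T4Family), (∃ θ : Stage13Params F N, θ.Provisos₁₃Core F N ∧ Rg F θ ∧ θ.Admissible F N) →
      N16HolderMSAt (ne3OfRecord₁₁ F (ne3ConstLayerOfRecord₁₁ F N (ℓ F))) β :=
  s_N16HolderMS_rRec₁₃CoPOn_iff_of_constLayer β 𝔯 Rg (fun F => ne3ConstLayerOfRecord₁₁ F N (ℓ F)) hpin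

/-- **THE `h16` READ-OUT AT THE OBJECT OF RECORD, REGIME-RESTRICTED, MS CURRENCY**. [folklore] -/
theorem n16HolderMSAt_of_s_N16HolderMS_rRec₁₃CoPOn_ofRecord (hS : S_N16HolderMS β (RRec₁₃CoPOn 𝔯 Rg)) (F : T4Family) {θ : Stage13Params F N}
    (hP : θ.Provisos₁₃Core F N) (hRg : Rg F θ) (hθ : θ.Admissible F N) : N16HolderMSAt (ne3OfRecord₁₁ F (ne3ConstLayerOfRecord₁₁ F N (ℓ F))) β :=
  (s_N16HolderMS_rRec₁₃CoPOn_iff_ofRecord β 𝔯 Rg ℓ hpin).1 hS F ⟨θ, hP, hRg, hθ⟩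

/-- ★ **N21's MS-FACE AT THE OBJECT OF RECORD, REGIME-RESTRICTED**: under the candidate stub, at every guarded family the MS β-root `CovRootHolderMS` at RR-1's period
`ne3NperOfRecord₁₁ F 0 0 = 2·L^m`, the letters `ℓ F` and the data of record `ne3DomOfRecord₁₁ F N 0 0` (`N16HolderMSAt` unfolded) — literally the hypothesis `h` of dag-n16-c's
NE7 consumer END `N16HolderMSDefs.closeness_of_covRootHolderMS` ((P) at `θ^{8k}`, (Gᶜ)∕(C)∕(Q) at `(θ^k)^{(12+14β)∕(1+β)}`, below the plaquette margin for every `β > 0`).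
[folklore] -/
theorem covRootHolderMS_rRec₁₃CoPOn_ofRecord (hS : S_N16HolderMS β (RRec₁₃CoPOn 𝔯 Rg)) (F : T4Family) {θ : Stage13Params F N} (hP : θ.Provisos₁₃Core F N) (hRg : Rg F θ)
    (hθ : θ.Admissible F N) :
    CovRootHolderMS 4 (sfClass 4 (ne3LOfRecord₁₁ F) (ne3NperOfRecord₁₁ F 0 0) (ℓ F).ε) (ne3LOfRecord₁₁ F) (ne3NperOfRecord₁₁ F 0 0) (ℓ F).b (ℓ F).g (ℓ F).C
      (ℓ F).Λ₁ (ℓ F).Λ₂' β (ne3DomOfRecord₁₁ F N 0 0) :=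
  n16HolderMSAt_of_s_N16HolderMS_rRec₁₃CoPOn_ofRecord β 𝔯 Rg ℓ hpin hS F hP hRg hθ

/-- **`S_N16HolderMS β` AT THE OBJECT OF RECORD, CANONICAL HOME** IS «`N16HolderMSAt (ne3OfRecord₁₁ F (ne3ConstLayerOfRecord₁₁ F N (ℓ F))) β` for every family carrying a Stage-13
datum of record». [folklore] -/
theorem s_N16HolderMS_rRec₁₃CoP_iff_ofRecord :
    S_N16HolderMS β (RRec₁₃CoP 𝔯) ↔ ∀ (F : T4Family), (∃ D : Datum F N, IsDatumOfRecord₁₃CCoP F N D) →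
      N16HolderMSAt (ne3OfRecord₁₁ F (ne3ConstLayerOfRecord₁₁ F N (ℓ F))) β :=
  s_N16HolderMS_rRec₁₃CoP_iff_of_constLayer β 𝔯 (fun F => ne3ConstLayerOfRecord₁₁ F N (ℓ F)) hpin

/-- **N21's MS-FACE AT THE OBJECT OF RECORD, CANONICAL HOME** (one family carrying a Stage-13 datum of record). [folklore] -/
theorem covRootHolderMS_rRec₁₃CoP_ofRecord (hS : S_N16HolderMS β (RRec₁₃CoP 𝔯)) (F : T4Family) {D : Datum F N} (hD : IsDatumOfRecord₁₃CCoP F N D) :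
    CovRootHolderMS 4 (sfClass 4 (ne3LOfRecord₁₁ F) (ne3NperOfRecord₁₁ F 0 0) (ℓ F).ε) (ne3LOfRecord₁₁ F) (ne3NperOfRecord₁₁ F 0 0) (ℓ F).b (ℓ F).g (ℓ F).C
      (ℓ F).Λ₁ (ℓ F).Λ₂' β (ne3DomOfRecord₁₁ F N 0 0) :=
  (s_N16HolderMS_rRec₁₃CoP_iff_ofRecord β 𝔯 ℓ hpin).1 hS F ⟨D, hD⟩

/-- **THE TWO HOMES AGREE AT THE OBJECT OF RECORD — CANONICAL ⇒ REGIME-RESTRICTED, EVERY REGIME**. [folklore] -/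
theorem s_N16HolderMS_rRec₁₃CoPOn_ofRecord_of_rRec₁₃CoP (hS : S_N16HolderMS β (RRec₁₃CoP 𝔯)) : S_N16HolderMS β (RRec₁₃CoPOn 𝔯 Rg) :=
  s_N16HolderMS_rRec₁₃CoPOn_of_s_N16HolderMS_rRec₁₃CoP_constLayer β 𝔯 Rg (fun F => ne3ConstLayerOfRecord₁₁ F N (ℓ F)) hpin hS

end OfRecord

/-! ## §4 At dag-n22-e's NAMED Stage-13 reading of record `readingOfRecord₁₃CoP w1 ℓ₃ ne2 ne1` (every `hpin` is `readingOfRecord₁₃CoP_ne3`, `rfl`) -/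

section NamedReading

variable (w1 : (F : T4Family) → (θ : Stage13Params F N) → ReadingData F (MatA N) θ.τ9.M) (ℓ₃ : T4Family → NE3Letters₁₁)
  (ne2 : (F : T4Family) → Stage13Params F N → (ℕ → ℝ) → List (ULoop F) → ℕ → NE2Objects₁₁)
  (ne1 : (F : T4Family) → Stage13Params F N → (ℕ → ℝ) → List (ULoop F) → NE1pCarriers)

/-- **`S_N16HolderMS β` AT THE REGIME-RESTRICTED READING OF RECORD** IS «`N16HolderMSAt` at RR-1's object with letters `ℓ₃ F` for every family carrying an admissible Stage-13
tuple with provisos in `Rg`» (the reading's `w1` ∕ `ne2` ∕ `ne1` are not read by N16). [folklore] -/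
theorem s_N16HolderMS_readingOfRecord₁₃CoPOn_iff :
    S_N16HolderMS β (RRec₁₃CoPOn (readingOfRecord₁₃CoP w1 ℓ₃ ne2 ne1) Rg) ↔
      ∀ (F : T4Family), (∃ θ : Stage13Params F N, θ.Provisos₁₃Core F N ∧ Rg F θ ∧ θ.Admissible F N) →
        N16HolderMSAt (ne3OfRecord₁₁ F (ne3ConstLayerOfRecord₁₁ F N (ℓ₃ F))) β :=
  s_N16HolderMS_rRec₁₃CoPOn_iff_ofRecord β _ Rg ℓ₃ (readingOfRecord₁₃CoP_ne3 w1 ℓ₃ ne2 ne1)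

/-- **`S_N16HolderMS β` AT THE CANONICAL READING OF RECORD** IS «`N16HolderMSAt` at RR-1's object with letters `ℓ₃ F` for every family carrying a Stage-13 datum of record».
[folklore] -/
theorem s_N16HolderMS_readingOfRecord₁₃CoP_iff :
    S_N16HolderMS β (RRec₁₃CoP (readingOfRecord₁₃CoP w1 ℓ₃ ne2 ne1)) ↔
      ∀ (F : T4Family), (∃ D : Datum F N, IsDatumOfRecord₁₃CCoP F N D) → N16HolderMSAt (ne3OfRecord₁₁ F (ne3ConstLayerOfRecord₁₁ F N (ℓ₃ F))) β :=
  s_N16HolderMS_rRec₁₃CoP_iff_ofRecord β _ ℓ₃ (readingOfRecord₁₃CoP_ne3 w1 ℓ₃ ne2 ne1)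

/-- ★ **N21's MS-FACE AT THE REGIME-RESTRICTED READING OF RECORD** — `CovRootHolderMS` at RR-1's period, the reading's letters `ℓ₃ F` and the data of record, at every guarded
family. [folklore] -/
theorem covRootHolderMS_readingOfRecord₁₃CoPOn (hS : S_N16HolderMS β (RRec₁₃CoPOn (readingOfRecord₁₃CoP w1 ℓ₃ ne2 ne1) Rg)) (F : T4Family) {θ : Stage13Params F N}
    (hP : θ.Provisos₁₃Core F N) (hRg : Rg F θ) (hθ : θ.Admissible F N) :
    CovRootHolderMS 4 (sfClass 4 (ne3LOfRecord₁₁ F) (ne3NperOfRecord₁₁ F 0 0) (ℓ₃ F).ε) (ne3LOfRecord₁₁ F) (ne3NperOfRecord₁₁ F 0 0) (ℓ₃ F).b (ℓ₃ F).g (ℓ₃ F).C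
      (ℓ₃ F).Λ₁ (ℓ₃ F).Λ₂' β (ne3DomOfRecord₁₁ F N 0 0) :=
  covRootHolderMS_rRec₁₃CoPOn_ofRecord β _ Rg ℓ₃ (readingOfRecord₁₃CoP_ne3 w1 ℓ₃ ne2 ne1) hS F hP hRg hθ

/-- **N21's MS-FACE AT THE CANONICAL READING OF RECORD** (one family carrying a Stage-13 datum of record). [folklore] -/
theorem covRootHolderMS_readingOfRecord₁₃CoP (hS : S_N16HolderMS β (RRec₁₃CoP (readingOfRecord₁₃CoP w1 ℓ₃ ne2 ne1))) (F : T4Family) {D : Datum F N}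
    (hD : IsDatumOfRecord₁₃CCoP F N D) :
    CovRootHolderMS 4 (sfClass 4 (ne3LOfRecord₁₁ F) (ne3NperOfRecord₁₁ F 0 0) (ℓ₃ F).ε) (ne3LOfRecord₁₁ F) (ne3NperOfRecord₁₁ F 0 0) (ℓ₃ F).b (ℓ₃ F).g (ℓ₃ F).C
      (ℓ₃ F).Λ₁ (ℓ₃ F).Λ₂' β (ne3DomOfRecord₁₁ F N 0 0) :=
  covRootHolderMS_rRec₁₃CoP_ofRecord β _ ℓ₃ (readingOfRecord₁₃CoP_ne3 w1 ℓ₃ ne2 ne1) hS F hD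

end NamedReading

/-! ## §5 Honesty (R422): the empty guard; the MS stub is refuted wherever the β-stub is -/

/-- **HONESTY FACE: THE MS STUB AT THE REGIME-RESTRICTED HOME IS VACUOUS WHEN THE GUARD IS EMPTY** — if no family has an admissible Stage-13 tuple with provisos in `Rg`, then
`S_N16HolderMS β (RRec₁₃CoPOn 𝔯 Rg)` for EVERY reading and EVERY exponent, content-free.  The existence of a guarded admissible tuple (K0‴ ∕ RR-2's CN key) is where the stub
starts to bite. [folklore] -/
theorem s_N16HolderMS_rRec₁₃CoPOn_of_guard_empty (hempty : ∀ (F : T4Family) (θ : Stage13Params F N), θ.Provisos₁₃Core F N → Rg F θ → ¬ θ.Admissible F N) :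
    S_N16HolderMS β (RRec₁₃CoPOn 𝔯 Rg) :=
  (s_N16HolderMS_rRec₁₃CoPOn_iff β 𝔯 Rg).2 fun F θ hP hRg hθ _ _ _ => absurd hθ (hempty F θ hP hRg)

/-- **THE MS STUB IS REFUTED WHEREVER THE β-STUB IS** (contrapositive of §1's side-condition-free weakening): every junk test of the β-currency at this home — e.g. a reading
pinning a negative Lipschitz letter at a guarded family (module 19 §7 at `β = 1`) — refutes `S_N16HolderMS β` as well. [folklore] -/
theorem not_s_N16HolderMS_rRec₁₃CoPOn_of_not_s_N16Holder (h : ¬ S_N16Holder β (RRec₁₃CoPOn 𝔯 Rg)) : ¬ S_N16HolderMS β (RRec₁₃CoPOn 𝔯 Rg) :=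
  fun hS => h (s_N16Holder_rRec₁₃CoPOn_of_s_N16HolderMS β 𝔯 Rg hS)

end

end Summit.QuantumFields.YangMills.BalabanUVNodes.N16HolderMSAtRecord13CoP
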